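import Summits.Ventures.QEC.Decoders.RadiusCheckTree
import Summits.Ventures.QEC.Census.BB.BB72.MitmX
import Summits.Ventures.QEC.Census.BB.BB72.MitmZ
import Literature.InformationTheory.QuantumCodes.SyndromeDecodingCSSPauli
import HarnessLib

/-!
# Ventures/QEC — Decoders/BB72SyndromeTable: the `[[72,12,6]]` distance certificate's meet-in-the-middle tables ARE a
# certified decoder of correction radius EXACTLY `2 = ⌊(6−1)/2⌋` (KERNEL; qec Q4 row for the benchmark code)

HONEST FRAMING: CERTIFIED column, tier KERNEL (only `decide +kernel` on four small word checks here; the two heavy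
replays are the ALREADY ACCEPTED distance-certificate theorems `BB72.mitmX_ok` / `BB72.mitmZ_ok`, ≈ 35 s kernel each;
axioms ⊆ {propext, Classical.choice, Quot.sound}). No code parameter is asserted here (the code's `d_Z = d_X = 6` are
the business of the distance files); nothing probabilistic.

THE CODE: `code = BB72.cert.code _` — the CSS code over `Fin 72` of the kernel-A distance certificate `BB72.cert`
(`Census/BB/BB72/Cert.lean`: check matrices `rowMatrix 72 cert.HX`, `rowMatrix 72 cert.HZ` = generator file
`census/search-3/gens/BB72.json`, matrix_sha256 `907fb1aa…`, the object of every BB72 census theorem).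

THE DECODER: the syndrome-table (bounded-distance) decoder of Ryan–Lin–Wilson §3.1.4: `treeDecoder 72 36 treeX` answers
an `H^Z`-syndrome with the unique `X`-pattern of weight `≤ 2` having that syndrome (the table `BB72.treeX` of
`Census/BB/BB72/MitmTreeX.lean`: all 2629 patterns of weight `≤ 2` keyed by syndrome) and with the trivial correction on
any other syndrome; `treeZ` likewise for `Z`-errors. By `Decoders/RadiusCheckTree.lean` (MITM ⇒ RADIUS) the (T1)
component of the accepted replays `cert.mitmX 3 2 posX treeX = true` / `cert.mitmZ 3 2 posZ treeZ = true` is exactly the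
route-I radius certificate of these decoders: radius `≥ 2` in each sector at zero extra kernel cost. EXACTNESS: on the
weight-3 `X`-error `{0,1,4}` (resp. `Z`-error `{0,1,2}`) the syndrome is not tabled, the answer is trivial, and the
residual (the error itself) has odd overlap with the certificate's own `Z`-logical `cert.sideZ.witness` (resp.
`X`-logical `cert.sideX.witness`), so it is not a stabilizer: radius EXACTLY `2` per sector and, by CSS separation
(`CSSCode.css_correctsUpTo_iff`, type-08 p463511), EXACTLY `2` in symplectic weight for the sector-wise Pauli decoder.
`2 = ⌊(6−1)/2⌋` is the full correction radius permitted by the certified distance `6` (`Decoder.CorrectsUpTo.le_half`).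

RELATION TO search-6's BP+OSD radius certificate (cert/radius/INDEX.tsv `rad-e685eb2646b4`, DATA file
`cert/radius/DATA/BB72__bposd_flooding_osdcs60__t2.data.json`, sha256 `070c444a…`): that file records BP+OSD (min-sum
flooding, OSD-CS λ = 60, Roffe et al. 2020 App. 10 / §5)'s output on every `X`- and `Z`-error of weight `≤ 2` — all
2 × 2629 recorded corrections ARE the error itself (checked by type-08's converter `tools/radius_tree_lean.py`), i.e. on
the weight-`≤ 2` syndromes the recorded BP+OSD table coincides entry for entry with `treeX` / `treeZ`, so `radiusX` /
`radiusZ` / `radiusPauli` below are at the same time the KERNEL statement of that recorded table's radius `≥ 2`. Its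
recorded weight-3 FAILURE (error `{0,3,6}` answered `{0,12,15,18,24}`) is certified here too: that residual is an
`X`-logical of weight `6` (`bposd_recordedFailure_residual_logical`). That the recorded table IS the software decoder's
behaviour is search-6's COMPUTED-column statement, not a kernel fact.
-/

namespace Summit.Ventures.QEC.Decoders.BB72

open Matrix Literature.InformationTheory.QuantumCodes Summit.Ventures.QEC.Census Summit.Ventures.QEC.Census.BB72

/-- The checks of the `BB72` certificate commute (`H^X (H^Z)ᵀ = 0` at the word level), by `decide +kernel`. -/
theorem commOK : Census.commOK cert.n cert.HX cert.HZ = true := by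
  decide +kernel

/-- The CSS code of the `BB72` certificate (qubits `Fin 72`, check matrices `rowMatrix 72 cert.HX / cert.HZ`) — the
same object as in the distance theorems (`cert.code _`; the proof argument is irrelevant to the value). (definition) -/
def code : CSSCode (Fin cert.HX.length) (Fin cert.HZ.length) (Fin cert.n) := cert.code commOK

/-! ## Radius ≥ 2 in each sector, for free from the distance certificate -/

/-- **CERTIFIED (KERNEL): the syndrome-table decoder `treeX` corrects every `X`-error of weight `≤ 2` on `[[72,12,6]]`**
— the (T1) half of the accepted mitm replay `BB72.mitmX_ok`, read through `DistCertRadius.correctsUpToX_of_mitmX`. -/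
theorem radiusX : (treeDecoder cert.n cert.HZ.length treeX).CorrectsUpTo code.xSyndrome
    (code.rowSpX : Set (Fin cert.n → ZMod 2)) hammingNorm 2 :=
  DistCertRadius.correctsUpToX_of_mitmX cert commOK mitmX_ok

/-- **CERTIFIED (KERNEL): the syndrome-table decoder `treeZ` corrects every `Z`-error of weight `≤ 2` on `[[72,12,6]]`**
(from `BB72.mitmZ_ok`). -/
theorem radiusZ : (treeDecoder cert.n cert.HX.length treeZ).CorrectsUpTo code.zSyndrome
    (code.rowSpZ : Set (Fin cert.n → ZMod 2)) hammingNorm 2 :=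
  DistCertRadius.correctsUpToZ_of_mitmZ cert commOK mitmZ_ok

/-- **CERTIFIED (KERNEL), Pauli level**: the sector-wise decoder `Decoder.css treeX treeZ` corrects every Pauli error of
symplectic weight `≤ 2` modulo the stabilizer space `code.toSympCode = rs H^X × rs H^Z` (CSS separation). -/
theorem radiusPauli :
    (Decoder.css (treeDecoder cert.n cert.HZ.length treeX) (treeDecoder cert.n cert.HX.length treeZ)).CorrectsUpTo
      (cssSyndrome code.xSyndrome code.zSyndrome) (code.toSympCode : Set (SympVec cert.n)) sympWeight 2 :=
  (code.css_correctsUpTo_iff _ _ 2).2 ⟨radiusX, radiusZ⟩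

/-! ## Exactness: certified failures at weight 3 -/

/-- `X`-sector failure witness: the weight-3 `X`-error word `19` (support `{0,1,4}`) has an untabled `H^Z`-syndrome
(trivial answer, residual = the error) and odd overlap with `u = cert.sideZ.witness = 1310771` (the certificate's
weight-6 `Z`-logical, orthogonal to every `H^X` row) — `decide +kernel`. -/
theorem failX : checkFailTreeX cert.n cert.HZ cert.HX treeX 2 19 1310771 = true := by
  decide +kernel

/-- `Z`-sector failure witness: the weight-3 `Z`-error word `7` (support `{0,1,2}`), untabled `H^X`-syndrome, odd
overlap with `u = cert.sideX.witness = 9682550849` (the certificate's weight-6 `X`-logical) — `decide +kernel`. -/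
theorem failZ : checkFailTreeX cert.n cert.HX cert.HZ treeZ 2 7 9682550849 = true := by
  decide +kernel

/-- The syndrome-table decoder `treeX` does NOT correct every `X`-error of weight `≤ 3`. -/
theorem not_radiusX_three : ¬ (treeDecoder cert.n cert.HZ.length treeX).CorrectsUpTo code.xSyndrome
    (code.rowSpX : Set (Fin cert.n → ZMod 2)) hammingNorm 3 :=
  not_correctsUpToX_of_checkFailTreeX _ failX

/-- The syndrome-table decoder `treeZ` does NOT correct every `Z`-error of weight `≤ 3`. -/
theorem not_radiusZ_three : ¬ (treeDecoder cert.n cert.HX.length treeZ).CorrectsUpTo code.zSyndrome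
    (code.rowSpZ : Set (Fin cert.n → ZMod 2)) hammingNorm 3 :=
  not_correctsUpToX_of_checkFailTreeX code.swap.comm failZ

/-- **CERTIFIED (KERNEL): the `X`-sector correction radius of the syndrome-table decoder on `[[72,12,6]]` is EXACTLY `2`.** -/
theorem isCorrectionRadiusX : (treeDecoder cert.n cert.HZ.length treeX).IsCorrectionRadius code.xSyndrome
    (code.rowSpX : Set (Fin cert.n → ZMod 2)) hammingNorm 2 :=
  ⟨radiusX, not_radiusX_three⟩

/-- **CERTIFIED (KERNEL): the `Z`-sector correction radius of the syndrome-table decoder on `[[72,12,6]]` is EXACTLY `2`.** -/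
theorem isCorrectionRadiusZ : (treeDecoder cert.n cert.HX.length treeZ).IsCorrectionRadius code.zSyndrome
    (code.rowSpZ : Set (Fin cert.n → ZMod 2)) hammingNorm 2 :=
  ⟨radiusZ, not_radiusZ_three⟩

/-- **CERTIFIED (KERNEL), Pauli level, EXACT: the sector-wise syndrome-table decoder of `[[72,12,6]]` has correction
radius EXACTLY `2 = ⌊(6−1)/2⌋` in symplectic weight.** -/
theorem isCorrectionRadiusPauli :
    (Decoder.css (treeDecoder cert.n cert.HZ.length treeX) (treeDecoder cert.n cert.HX.length treeZ)).IsCorrectionRadius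
      (cssSyndrome code.xSyndrome code.zSyndrome) (code.toSympCode : Set (SympVec cert.n)) sympWeight 2 :=
  ⟨radiusPauli, fun h => not_radiusX_three ((code.css_correctsUpTo_iff _ _ 3).1 h).1⟩

/-! ## search-6's recorded BP+OSD failure at weight 3 is a genuine failure -/

/-- The recorded BP+OSD (min-sum flooding, OSD-CS 60) answer on the weight-3 `X`-error `{0,3,6}` (word `73`) is the
word `17076225` (support `{0,12,15,18,24}`); the residual `17076225 ⊕ 73 = 17076296` (support `{3,6,12,15,18,24}`)
passes the upper-witness check of the distance checker against `u = 1310771`: zero `H^Z`-syndrome, weight `6`, odd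
overlap with a vector orthogonal to all `H^X` rows — `decide +kernel`. (Data: the DATA file's `failure_witness`.) -/
theorem bposd_recordedFailure_upperOK : Census.upperOK cert.n cert.HZ cert.HX 6 (17076225 ^^^ 73) 1310771 = true := by
  decide +kernel

/-- **The recorded BP+OSD residual on the `X`-error `{0,3,6}` is an `X`-logical of weight `6`** (zero `H^Z`-syndrome, not
in the row space of `H^X`): that recorded answer does not correct this weight-3 error — the KERNEL part of search-6's
«radius of BP+OSD on `[[72,12,6]]` is exactly 2» (the recorded table's radius `≥ 2` being `radiusX`/`radiusZ` above). -/
theorem bposd_recordedFailure_residual_logical :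
    Census.rowMatrix cert.n cert.HZ *ᵥ Census.ofBits cert.n (17076225 ^^^ 73) = 0 ∧
      Census.ofBits cert.n (17076225 ^^^ 73) ∉ rowSpace (Census.rowMatrix cert.n cert.HX) ∧
      hammingNorm (Census.ofBits cert.n (17076225 ^^^ 73)) = 6 :=
  Census.upper_sound bposd_recordedFailure_upperOK

end Summit.Ventures.QEC.Decoders.BB72
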